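import Literature.AnabelianGeometry.SemiGraphs.ZariskiMainTheorem

/-!
# Proof of [SemiAnbd] Lemma 1.4: every finite graph immerses into some `H_n`

Mochizuki, *Semi-graphs of anabelioids*, Publ. RIMS **42** (2006) 221–322, §1, Lemma 1.4 p. 17
[cite: MochizukiSemiAnbd2006, Lem. 1.4 p.17]: "Every finite graph `G` admits an immersion `G → H_n`
for some integer `n ≥ 1`.  Proof. Indeed, if we take `n` to be the number of edges of `G` and assign
distinct colors to distinct edges of `G`, then it is immediate from Lemma 1.3, (ii), that (for any
assignment of orientations) the resulting morphism `G → H_n` is an immersion."  We follow the printed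
proof (with `n` = number of edges `+ 1`, so that `n ≥ 1` also when `G` has no edges), discharging the
named fact `SemiGraph.lemma_1_4` of `ZariskiMainTheorem.lean`.
-/

namespace Literature.AnabelianGeometry.SemiGraphs

namespace SemiGraph

open CategoryTheory

universe u

/-- Every edge of a semi-graph admits an orientation (a bijection of its two branches with `Bool`).
[cite: MochizukiSemiAnbd2006, Lem. 1.3(i) p.17] -/
theorem nonempty_orientation (G : SemiGraph.{u}) : Nonempty G.Orientation := by
  classical
  refine ⟨fun e => Classical.choice ?_⟩
  obtain ⟨b₁, b₂, hne, h₁, h₂, hall⟩ := G.two_branches e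
  refine ⟨{ toFun := fun b => decide (b.1 = b₁)
            invFun := fun t => if t then ⟨b₁, h₁⟩ else ⟨b₂, h₂⟩
            left_inv := fun b => ?_
            right_inv := fun t => ?_ }⟩
  · rcases hall b.1 b.2 with h | h
    · simp only [h, decide_true, if_true]; exact Subtype.ext h.symm
    · have hb : b.1 ≠ b₁ := by rw [h]; exact hne.symm
      simp only [hb, decide_false]; exact Subtype.ext h.symm
  · cases t
    · simp [hne.symm]
    · simp

/-- The "key" transport fact: equal values of an orientation on branches of equal edges force the
branches to coincide. [cite: MochizukiSemiAnbd2006, Lem. 1.3(i) p.17] -/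
theorem Orientation.eq_of_eq {G : SemiGraph.{u}} (o : G.Orientation) {e₁ e₂ : G.Edge} (hx : e₁ = e₂)
    (x : {b // G.edgeOf b = e₁}) (y : {b // G.edgeOf b = e₂}) (h : o e₁ x = o e₂ y) : x.1 = y.1 := by
  subst hx
  exact congrArg Subtype.val ((o e₁).injective h)

/-- [SemiAnbd] Lemma 1.4, PROVED along the printed proof: colour the edges injectively (into
`Fin (#edges + 1)`), orient them arbitrarily, and apply Lemma 1.3 (ii).
[cite: MochizukiSemiAnbd2006, Lem. 1.4 p.17] -/
theorem lemma_1_4_holds : lemma_1_4.{u} := by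
  intro G hG _
  classical
  haveI := hG.finite_edge
  obtain ⟨m, ⟨eqv⟩⟩ := Finite.exists_equiv_fin G.Edge
  obtain ⟨o⟩ := G.nonempty_orientation
  let c : G.Coloring (m + 1) := fun e => ⟨Fin.castSucc (eqv e)⟩
  have hc : Function.Injective c := fun e₁ e₂ h =>
    eqv.injective (Fin.castSucc_injective _ (congrArg ULift.down h))
  refine ⟨m + 1, Nat.succ_le_succ (Nat.zero_le _), toBouquet o c, ?_⟩
  rw [lemma_1_3_ii hG]
  intro v i dir
  -- the branches at `v` of colour `i` and direction `dir` form a subsingleton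
  have hsub : Subsingleton {b : G.Star v // ((toBouquet o c).branchMap b.1).down = (i, dir)} := by
    refine ⟨fun x y => Subtype.ext (Subtype.ext ?_)⟩
    have hx := x.2
    have hy := y.2
    change ((c (G.edgeOf x.1.1)).down, o (G.edgeOf x.1.1) ⟨x.1.1, rfl⟩) = (i, dir) at hx
    change ((c (G.edgeOf y.1.1)).down, o (G.edgeOf y.1.1) ⟨y.1.1, rfl⟩) = (i, dir) at hy
    have he : G.edgeOf x.1.1 = G.edgeOf y.1.1 :=
      hc (congrArg ULift.up ((congrArg Prod.fst hx).trans (congrArg Prod.fst hy).symm))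
    exact o.eq_of_eq he ⟨x.1.1, rfl⟩ ⟨y.1.1, rfl⟩
      ((congrArg Prod.snd hx).trans (congrArg Prod.snd hy).symm)
  -- and `G.Star v` is finite (branches inject into edges × Bool via the orientation)
  haveI : Finite (G.Star v) := by
    refine Finite.of_injective (fun b : G.Star v => (G.edgeOf b.1, o (G.edgeOf b.1) ⟨b.1, rfl⟩))
      fun b₁ b₂ h => ?_
    exact Subtype.ext (o.eq_of_eq (congrArg Prod.fst h) ⟨b₁.1, rfl⟩ ⟨b₂.1, rfl⟩
      (congrArg Prod.snd h))
  rw [colourDegree, Finite.card_le_one_iff_subsingleton]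
  exact hsub

end SemiGraph

end Literature.AnabelianGeometry.SemiGraphs
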